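import Summits.PneNP.PneNP.Theorems.Sd2BlMachineDictLabels
import Summits.PneNP.PneNP.Theorems.Sd2BlMachineRows

/-!
# K1'' machine side (S3), DICTIONARY D3: the canonical certificate's side of the binders

Cell pnp-ideate, ROUND-18 item K1''.  The dictionary files D1–D2 are generic in a certificate `c` and coefficient
tables `(F0, F1, F2)` under `hF`; the closer instantiates them with the CANONICAL degree-2 certificate of an
all-sign-degree-≤2 instance (`SignDeg2Signing.canonCert I h`, by `rfl` the term
`certOfIntCert I le_rfl (fun j => certOf k 2 (I.table j) (h j))`) and the rows of `rowTable₂` (M0).  This file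
discharges, for that instantiation, the binders that do not depend on the machine run:

* **`hF_canon`** — `coef c j κ = coefF k F0₂ F1₂ F2₂ (I.table j) κ` for the three components `F0₂ / F1₂ / F2₂` of
  `rowTable₂ k` (by `canonCert_c0 / _c1 / _c2`, case split on the kind);
* **`card_legs_out_le_ell`** — every output has at most `ell k := max 3 (2·(uniformW k 2).toNat)` legs (`hout`, with
  `three_le_ell` for `hℓ`), from `SignDeg2Legs.card_legs_out_le_of_intCert`;
* **`nonempty_CLeg_canon`** — with at least one output there is a leg (margin `2 ≤ …` forces a nonzero coefficient),
  the `Nonempty` instance behind `one_le_card_piecesI` (`hN1`).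

Restricted-model algorithmic infrastructure; nothing here bears on `P` versus `NP`.
-/

set_option linter.dupNamespace false -- `Summit.PneNP.PneNP.…`: summit = sub-problem name (D-0017 single-conjunct layout)

namespace Summit.PneNP.PneNP.Theorems.Sd2BlMachine

open Literature.Computability.Complexity
open Summit.PneNP.PneNP.Theorems.SignRepCertificate (Cert pm)
open Summit.PneNP.PneNP.Theorems.SignDegCertBridge (certOf certOfIntCert uniformW uniformW_nonneg)
open Summit.PneNP.PneNP.Theorems.SignDeg2Legs (Kind coef CLeg card_legs_out card_legs_out_le_of_intCert)

variable {k n m : ℕ}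

/-! ## The coefficient tables of the canonical rows -/

/-- Bias table: first component of `rowTable₂`. -/
noncomputable def F0₂ (k : ℕ) (P : (Fin k → Bool) → Bool) : ℤ := (rowTable₂ k P).1

/-- Slot table: second component of `rowTable₂`. -/
noncomputable def F1₂ (k : ℕ) (P : (Fin k → Bool) → Bool) (i : Fin k) : ℤ := (rowTable₂ k P).2.1 i

/-- Pair table: third component of `rowTable₂`. -/
noncomputable def F2₂ (k : ℕ) (P : (Fin k → Bool) → Bool) (i i' : Fin k) : ℤ := (rowTable₂ k P).2.2 i i'

/-- **`hF` for the canonical certificate**: its coefficients are read off the tables `F0₂ / F1₂ / F2₂`. -/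
theorem hF_canon (I : LocalMap k n m) (h : ∀ j, SignDegLE 2 (I.table j)) (j : Fin m) (κ : Kind k) :
    coef (certOfIntCert I le_rfl fun j => certOf k 2 (I.table j) (h j)) j κ = coefF k (F0₂ k) (F1₂ k) (F2₂ k) (I.table j) κ := by
  rcases κ with ⟨⟨⟩⟩ | ⟨i | ⟨i, i'⟩⟩
  · exact canonCert_c0 I h j
  · exact canonCert_c1 I h j i
  · exact canonCert_c2 I h j i i'

/-! ## Legs per output -/

/-- The legs-per-output bound of the sd-2 machine: `ℓ = max 3 (2·W)`, `W = uniformW k 2`. -/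
noncomputable def ell (k : ℕ) : ℕ := max 3 (2 * (uniformW k 2).toNat)

/-- `3 ≤ ℓ` (the `hℓ` binder of `Sd2Bl.legBound_of_pipeline`). -/
theorem three_le_ell (k : ℕ) : 3 ≤ ell k := le_max_left _ _

/-- **`hout`**: every output of the canonical certificate owns at most `ℓ` legs. -/
theorem card_legs_out_le_ell (I : LocalMap k n m) (h : ∀ j, SignDegLE 2 (I.table j)) (j : Fin m) :
    (Finset.univ.filter fun e : CLeg (certOfIntCert I le_rfl fun j => certOf k 2 (I.table j) (h j)) => e.out = j).card ≤ ell k := by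
  have hz := card_legs_out_le_of_intCert I le_rfl (fun j => certOf k 2 (I.table j) (h j)) j
  have hW := uniformW_nonneg k 2
  refine le_trans ?_ (le_max_right _ _)
  have : ((Finset.univ.filter fun e : CLeg (certOfIntCert I le_rfl fun j => certOf k 2 (I.table j) (h j)) => e.out = j).card : ℤ)
      ≤ ((2 * (uniformW k 2).toNat : ℕ) : ℤ) := by
    rw [Nat.cast_mul, Nat.cast_ofNat, Int.toNat_of_nonneg hW]; exact hz
  exact_mod_cast this

/-! ## Nonemptiness -/

/-- Every output of the canonical certificate owns at least one leg (margin `2` forces a nonzero coefficient). -/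
theorem exists_leg_out (I : LocalMap k n m) (h : ∀ j, SignDegLE 2 (I.table j)) (j : Fin m) :
    ∃ e : CLeg (certOfIntCert I le_rfl fun j => certOf k 2 (I.table j) (h j)), e.out = j := by
  classical
  set c := certOfIntCert I le_rfl fun j => certOf k 2 (I.table j) (h j) with hc
  by_contra hne
  push Not at hne
  have hcard : (Finset.univ.filter fun e : CLeg c => e.out = j).card = 0 :=
    Finset.card_eq_zero.2 (Finset.filter_eq_empty_iff.2 fun e _ => hne e)
  have hsum := card_legs_out c j
  rw [hcard, Nat.cast_zero] at hsum
  -- all coefficients of output j vanish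
  have h0 : c.c0 j = 0 := by
    have := abs_nonneg (c.c0 j)
    have h1 : (0 : ℤ) ≤ ∑ i, |c.c1 j i| := Finset.sum_nonneg fun _ _ => abs_nonneg _
    have h2 : (0 : ℤ) ≤ ∑ i, ∑ i', |c.c2 j i i'| := Finset.sum_nonneg fun _ _ => Finset.sum_nonneg fun _ _ => abs_nonneg _
    exact abs_eq_zero.1 (by linarith)
  have h1 : ∀ i, c.c1 j i = 0 := by
    intro i
    have hs : ∑ i, |c.c1 j i| = 0 := by
      have := abs_nonneg (c.c0 j)
      have h2 : (0 : ℤ) ≤ ∑ i, ∑ i', |c.c2 j i i'| := Finset.sum_nonneg fun _ _ => Finset.sum_nonneg fun _ _ => abs_nonneg _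
      have h1 : (0 : ℤ) ≤ ∑ i, |c.c1 j i| := Finset.sum_nonneg fun _ _ => abs_nonneg _
      linarith
    exact abs_eq_zero.1 ((Finset.sum_eq_zero_iff_of_nonneg fun _ _ => abs_nonneg _).1 hs i (Finset.mem_univ _))
  have h2 : ∀ i i', c.c2 j i i' = 0 := by
    intro i i'
    have hs : ∑ i, ∑ i', |c.c2 j i i'| = 0 := by
      have := abs_nonneg (c.c0 j)
      have h1 : (0 : ℤ) ≤ ∑ i, |c.c1 j i| := Finset.sum_nonneg fun _ _ => abs_nonneg _
      have h2 : (0 : ℤ) ≤ ∑ i, ∑ i', |c.c2 j i i'| := Finset.sum_nonneg fun _ _ => Finset.sum_nonneg fun _ _ => abs_nonneg _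
      linarith
    have hi := (Finset.sum_eq_zero_iff_of_nonneg fun _ _ => Finset.sum_nonneg fun _ _ => abs_nonneg _).1 hs i (Finset.mem_univ _)
    exact abs_eq_zero.1 ((Finset.sum_eq_zero_iff_of_nonneg fun _ _ => abs_nonneg _).1 hi i' (Finset.mem_univ _))
  -- but the margin is `2 ≤ pm(P u)·g(u)`, and `g ≡ 0`
  have hv := c.valid j (fun _ => false)
  simp only [h0, h1, h2, zero_mul, Finset.sum_const_zero, add_zero, mul_zero] at hv
  have hτ : c.τ = 2 := rfl
  rw [hτ] at hv
  exact absurd hv (by norm_num)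

/-- **`hN1` supplier**: with at least one output, the canonical certificate has a leg. -/
theorem nonempty_CLeg_canon (I : LocalMap k n m) (h : ∀ j, SignDegLE 2 (I.table j)) (hm : 0 < m) :
    Nonempty (CLeg (certOfIntCert I le_rfl fun j => certOf k 2 (I.table j) (h j))) := by
  obtain ⟨e, _⟩ := exists_leg_out I h ⟨0, hm⟩
  exact ⟨e⟩

end Summit.PneNP.PneNP.Theorems.Sd2BlMachine
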